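import Mathlib
import Literature.Combinatorics.Enumerative.BregmanMinc
import Summits.ValiantsHypothesis.ValiantsHypothesis.Theorems.DivisionGapPerCofactorDegreeReductionStubMatchingPaddingChernoff
import Summits.ValiantsHypothesis.ValiantsHypothesis.Theorems.DivisionGapPerCofactorDegreeReductionStubMatchingPaddingEstimates

/-!
# `DivisionGap.PerCofactorDegreeReduction` (stmt-ValiantsHypothesis-15046), line `Sketch_ideator4`
(idea intrinsic-member-descent): random matching padding (stub `stub_matchingPadding`) — part 3/3,
the theorem

**Theorem (`stub_matchingPadding`).**  For every `d` there is `n₀` such that for all `n ≥ n₀` and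
every cell set `S₀ ⊆ [n] × [n]` with all row and column degrees `≤ d` there is a set `M` of at most
`400 (d + 1)` permutations of `[n]` such that, in the host `G = S₀ ∪ ⋃_{π ∈ M} graph π`
(`graph π = {(π i, i)}`, cells are `(row, column) = (σ i, i)`), for EVERY balanced split `(S, T)`
(`n/3 < |S| = |T| ≤ 2n/3`) the perfect matchings `σ` of `G` respecting the split (`σ(T) = S`) are
at most a `2^{-⌊n/10⌋}` fraction of all perfect matchings of `G`.

## Proof (probabilistic method, by counting; parts 1–2: sibling files `…Chernoff`, `…Estimates`)

Let `r = 400 (d + 1)` and count over all `r`-tuples `ω : Fin r → 𝔖_n` (`(n!)^r` of them).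

* `exists_good_tuple` (union bound over the `≤ 4^n` splits with the per-split tail bound of part 1,
  plus Markov for the agreements): some tuple has at most `2 r²` ordered agreements
  `#{(i, k ≠ l) : ω k i = ω l i}` and, for every split with `3|S| ≤ 2n`, `|T| = |S| = s`, total hit
  count `∑_k #{j ∈ T : ω k j ∈ S} ≤ r (s²/n + n/10)`.  Take `M = image ω`.
* Lower bound (part 2): `A = ∑_k P_{ω k}` has line sums `r`, so van der Waerden gives
  `per A ≥ n! rⁿ/nⁿ ≥ (r/e)ⁿ`, and `per A ≤ e^{2r²} #PM(G)` (a permutation contributes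
  `∏_i #{k : ω k i = σ i}`, zero off the padding graph and `≤ e^{agreements}` on it).
* Upper bound (`main_ineq`): a respecting matching has `σ j ∈ S ↔ j ∈ T`, so it is a system of
  distinct representatives of the block supports `B_j = {x : (x, j) ∈ G, (x ∈ S ↔ j ∈ T)}`, and
  Brégman–Minc gives `log #resp ≤ ∑_j log(|B_j|!)/|B_j|`.  The block degrees sum to
  `≤ n d + r (n - 2s) + 2 ∑_k hits ≤ n (d + r (5/9 + 1/5)) ≤ n K`, `K = 19r/25` (`card_block_le`,
  `sum_card_filter_iff`, `split_geometry`), so the affine majorant of `log(m!)/m` gives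
  `log #resp ≤ n (log K - 1 + 4 log K/K)`; with `numeric_bound` and `n ≥ n₀ = 25 r² + 2`,
  `⌊n/10⌋ log 2 + log #resp ≤ n log r - n - 2r² ≤ log #PM(G)`.

Only the column-degree hypothesis on `S₀` is used; constants are not optimised.
-/

-- `Summit.ValiantsHypothesis.ValiantsHypothesis.…` is the tree's mandated single-conjunct layout
-- (Sub = Summit), so the duplicated namespace component is intended.
set_option linter.dupNamespace false

open scoped NNReal BigOperators
open Finset

namespace Summit.ValiantsHypothesis.ValiantsHypothesis.Theorems.DivisionGap.PerCofactorDegreeReduction.MatchingPadding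

variable {n r : ℕ}

/-! ### A good tuple of permutations exists -/

/-- **A good tuple exists.**  For `r ≥ 400` and `n ≥ 2` some `r`-tuple of permutations of `Fin n`
has at most `2 r²` agreements and, for every split `(S, T)` with `3|S| ≤ 2n`, `|T| = |S|`, total
hit count `∑_k #{j ∈ T : ω k j ∈ S} ≤ r (|S|²/n + n/10)` (union bound over the `≤ 4^n` splits
plus Markov for the agreements). [folklore] -/
theorem exists_good_tuple (hr : 400 ≤ r) (hn : 2 ≤ n) :
    ∃ ω : Fin r → Equiv.Perm (Fin n),
      (∑ i, (Finset.univ.filter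
        fun p : Fin r × Fin r => p.1 ≠ p.2 ∧ ω p.1 i = ω p.2 i).card) ≤ 2 * r ^ 2 ∧
      ∀ S T : Finset (Fin n), 3 * S.card ≤ 2 * n → T.card = S.card →
        ∑ k, ((T.filter fun j => ω k j ∈ S).card : ℝ) ≤ r * ((S.card : ℝ) ^ 2 / n + n / 10) := by
  classical
  set bad0 := (Finset.univ : Finset (Fin r → Equiv.Perm (Fin n))).filter
    fun ω => 2 * r ^ 2 <
      (∑ i, (Finset.univ.filter
        fun p : Fin r × Fin r => p.1 ≠ p.2 ∧ ω p.1 i = ω p.2 i).card) with hbad0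
  set badST : Finset (Fin n) × Finset (Fin n) → Finset (Fin r → Equiv.Perm (Fin n)) := fun p =>
    (Finset.univ : Finset (Fin r → Equiv.Perm (Fin n))).filter fun ω =>
      (r : ℝ) * ((p.1.card : ℝ) ^ 2 / n + n / 10) <
        ∑ k, ((p.2.filter fun j => ω k j ∈ p.1).card : ℝ) with hbadST
  set pairs := (Finset.univ : Finset (Finset (Fin n) × Finset (Fin n))).filter
    fun p => 3 * p.1.card ≤ 2 * n ∧ p.2.card = p.1.card with hpairs
  have hU : 4 * (pairs.biUnion badST).card ≤ Fintype.card (Fin r → Equiv.Perm (Fin n)) := by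
    have h1 : (pairs.biUnion badST).card * 4 ^ (n + 1) ≤
        pairs.card * Fintype.card (Fin r → Equiv.Perm (Fin n)) := by
      calc (pairs.biUnion badST).card * 4 ^ (n + 1)
          ≤ (∑ p ∈ pairs, (badST p).card) * 4 ^ (n + 1) := by
            gcongr; exact Finset.card_biUnion_le
        _ = ∑ p ∈ pairs, (badST p).card * 4 ^ (n + 1) := Finset.sum_mul _ _ _
        _ ≤ ∑ p ∈ pairs, Fintype.card (Fin r → Equiv.Perm (Fin n)) :=
            Finset.sum_le_sum fun p hp => card_badSplit_mul_le hr hn p.1 p.2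
              (Finset.mem_filter.mp hp).2.1 (Finset.mem_filter.mp hp).2.2
        _ = pairs.card * Fintype.card (Fin r → Equiv.Perm (Fin n)) := by
            rw [Finset.sum_const, smul_eq_mul]
    have h2 : pairs.card ≤ 4 ^ n := by
      calc pairs.card ≤ (Finset.univ : Finset (Finset (Fin n) × Finset (Fin n))).card :=
            Finset.card_filter_le _ _
        _ = 4 ^ n := by
            rw [Finset.card_univ, Fintype.card_prod, Fintype.card_finset, Fintype.card_fin,
              ← mul_pow]
            norm_num
    have h3 : 4 ^ n * (4 * (pairs.biUnion badST).card) ≤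
        4 ^ n * Fintype.card (Fin r → Equiv.Perm (Fin n)) := by
      calc 4 ^ n * (4 * (pairs.biUnion badST).card)
          = (pairs.biUnion badST).card * 4 ^ (n + 1) := by ring
        _ ≤ pairs.card * Fintype.card (Fin r → Equiv.Perm (Fin n)) := h1
        _ ≤ 4 ^ n * Fintype.card (Fin r → Equiv.Perm (Fin n)) := by gcongr
    exact Nat.le_of_mul_le_mul_left h3 (by positivity)
  have h0 : 2 * bad0.card < Fintype.card (Fin r → Equiv.Perm (Fin n)) :=
    two_mul_card_filter_agr_lt
  have hlt : (bad0 ∪ pairs.biUnion badST).card <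
      (Finset.univ : Finset (Fin r → Equiv.Perm (Fin n))).card := by
    rw [Finset.card_univ]
    have := Finset.card_union_le bad0 (pairs.biUnion badST)
    omega
  obtain ⟨ω, -, hω⟩ := Finset.exists_mem_notMem_of_card_lt_card hlt
  rw [Finset.mem_union, not_or] at hω
  refine ⟨ω, ?_, ?_⟩
  · have h := hω.1
    rw [hbad0, Finset.mem_filter] at h
    by_contra hcon
    exact h ⟨Finset.mem_univ _, lt_of_not_ge hcon⟩
  · intro S T hS hT
    by_contra hcon
    apply hω.2
    rw [Finset.mem_biUnion]
    exact ⟨(S, T), Finset.mem_filter.mpr ⟨Finset.mem_univ _, hS, hT⟩,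
      Finset.mem_filter.mpr ⟨Finset.mem_univ _, lt_of_not_ge hcon⟩⟩


/-! ### Block structure of split-respecting matchings and block degrees -/

/-- Membership in the padding graph `⋃_{π ∈ image ω} graph π`: `(x, i)` is a padding cell iff
`ω k i = x` for some `k`. [folklore] -/
theorem mem_padding (ω : Fin r → Equiv.Perm (Fin n)) (x i : Fin n) :
    (x, i) ∈ (Finset.univ.image ω).biUnion (fun π => Finset.univ.image fun i => (π i, i)) ↔
      ∃ k, ω k i = x := by
  simp only [Finset.mem_biUnion, Finset.mem_image, Finset.mem_univ, true_and, Prod.mk.injEq]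
  constructor
  · rintro ⟨π, ⟨k, rfl⟩, i', hπ, rfl⟩
    exact ⟨k, hπ⟩
  · rintro ⟨k, hk⟩
    exact ⟨ω k, ⟨k, rfl⟩, i, hk, rfl⟩

/-- Block degree of a column `j` in the host `S₀ ∪ padding`: at most `d` cells from `S₀`
(column degree bound) plus `#{k : (ω k j ∈ S ↔ j ∈ T)}` padding cells. [folklore] -/
theorem card_block_le (ω : Fin r → Equiv.Perm (Fin n)) (S₀ : Finset (Fin n × Fin n)) {d : ℕ}
    (hcol : ∀ j : Fin n, (S₀.filter fun e => e.2 = j).card ≤ d) (S T : Finset (Fin n))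
    (j : Fin n) :
    ((Finset.univ : Finset (Fin n)).filter fun x =>
        (x, j) ∈ S₀ ∪ (Finset.univ.image ω).biUnion (fun π => Finset.univ.image fun i => (π i, i)) ∧
          (x ∈ S ↔ j ∈ T)).card ≤
      d + ((Finset.univ : Finset (Fin r)).filter fun k => (ω k j ∈ S ↔ j ∈ T)).card := by
  have h0d : ((Finset.univ : Finset (Fin n)).filter fun x => (x, j) ∈ S₀).card ≤ d := by
    refine le_trans ?_ (hcol j)
    refine Finset.card_le_card_of_injOn (fun x => (x, j)) (fun x hx => ?_) (fun x _ y _ h => ?_)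
    · rw [Finset.mem_coe, Finset.mem_filter] at hx
      rw [Finset.mem_coe, Finset.mem_filter]
      exact ⟨hx.2, rfl⟩
    · exact (Prod.mk.inj h).1
  calc ((Finset.univ : Finset (Fin n)).filter fun x =>
        (x, j) ∈ S₀ ∪ (Finset.univ.image ω).biUnion (fun π => Finset.univ.image fun i => (π i, i)) ∧
          (x ∈ S ↔ j ∈ T)).card
      ≤ (((Finset.univ : Finset (Fin n)).filter fun x => (x, j) ∈ S₀) ∪
          (((Finset.univ : Finset (Fin r)).filter fun k => (ω k j ∈ S ↔ j ∈ T)).image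
            fun k => ω k j)).card := by
        apply Finset.card_le_card
        intro x hx
        rw [Finset.mem_filter] at hx
        obtain ⟨-, hxG, hxiff⟩ := hx
        rw [Finset.mem_union] at hxG ⊢
        rcases hxG with h0 | hP
        · left
          exact Finset.mem_filter.mpr ⟨Finset.mem_univ _, h0⟩
        · right
          rw [mem_padding] at hP
          obtain ⟨k, hk⟩ := hP
          rw [Finset.mem_image]
          refine ⟨k, Finset.mem_filter.mpr ⟨Finset.mem_univ _, ?_⟩, hk⟩
          rwa [hk]
    _ ≤ ((Finset.univ : Finset (Fin n)).filter fun x => (x, j) ∈ S₀).card +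
          (((Finset.univ : Finset (Fin r)).filter fun k => (ω k j ∈ S ↔ j ∈ T)).image
            fun k => ω k j).card := Finset.card_union_le _ _
    _ ≤ d + ((Finset.univ : Finset (Fin r)).filter fun k => (ω k j ∈ S ↔ j ∈ T)).card :=
        add_le_add h0d Finset.card_image_le

/-! ### Assembly -/

/-- **The padding expansion inequality for a good tuple.**  If `ω` is an `r = 400(d+1)`-tuple with
`agr ω ≤ 2r²` and the discrepancy property of `exists_good_tuple`, `n ≥ 25 r² + 2`, and `S₀` has
column degrees `≤ d`, then for every balanced split `(S, T)` the split-respecting perfect matchings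
of `G = S₀ ∪ padding` are at most a `2^{-⌊n/10⌋}` fraction of all perfect matchings of `G`:
lower bound `#PM(G) ≥ rⁿ e^{-n} e^{-2r²}` (van der Waerden on `countMatrix ω / r`), upper bound
`log #resp ≤ n (log K - 1 + 4 log K / K)`, `K = 19r/25` (Brégman–Minc on the block supports).
[folklore] -/
theorem main_ineq {d n r : ℕ} (hr : 400 * (d + 1) ≤ r) (ω : Fin r → Equiv.Perm (Fin n))
    (hn : 25 * r ^ 2 + 2 ≤ n)
    (hagr : (∑ i, (Finset.univ.filter
      fun p : Fin r × Fin r => p.1 ≠ p.2 ∧ ω p.1 i = ω p.2 i).card) ≤ 2 * r ^ 2)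
    (hdisc : ∀ S T : Finset (Fin n), 3 * S.card ≤ 2 * n → T.card = S.card →
        ∑ k, ((T.filter fun j => ω k j ∈ S).card : ℝ) ≤ (r : ℝ) * ((S.card : ℝ) ^ 2 / n + n / 10))
    (S₀ : Finset (Fin n × Fin n)) (hcol : ∀ j : Fin n, (S₀.filter fun e => e.2 = j).card ≤ d)
    (S T : Finset (Fin n)) (hS1 : n < 3 * S.card) (hS2 : 3 * S.card ≤ 2 * n)
    (hST : S.card = T.card) :
    2 ^ (n / 10) *
        ((Finset.univ : Finset (Equiv.Perm (Fin n))).filter (fun σ : Equiv.Perm (Fin n) =>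
          (∀ i, (σ i, i) ∈ S₀ ∪ (Finset.univ.image ω).biUnion fun π =>
              Finset.univ.image fun i => (π i, i)) ∧
            T.image ⇑σ = S)).card ≤
      ((Finset.univ : Finset (Equiv.Perm (Fin n))).filter (fun σ : Equiv.Perm (Fin n) =>
          ∀ i, (σ i, i) ∈ S₀ ∪ (Finset.univ.image ω).biUnion fun π =>
            Finset.univ.image fun i => (π i, i))).card := by
  set G : Finset (Fin n × Fin n) := S₀ ∪ (Finset.univ.image ω).biUnion fun π =>
    Finset.univ.image fun i => (π i, i) with hG
  set PM : Finset (Equiv.Perm (Fin n)) := (Finset.univ : Finset (Equiv.Perm (Fin n))).filter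
    (fun σ : Equiv.Perm (Fin n) => ∀ i, (σ i, i) ∈ G) with hPM
  set RESP : Finset (Equiv.Perm (Fin n)) := (Finset.univ : Finset (Equiv.Perm (Fin n))).filter
    (fun σ : Equiv.Perm (Fin n) => (∀ i, (σ i, i) ∈ G) ∧ T.image ⇑σ = S) with hRESP
  have hr400 : 400 ≤ r := le_trans (by omega) hr
  have hr0 : 0 < r := by omega
  have hn0 : 0 < n := by omega
  have hrR : (400 : ℝ) ≤ r := by exact_mod_cast hr400
  have hnR : (25 : ℝ) * (r : ℝ) ^ 2 + 2 ≤ n := by exact_mod_cast hn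
  -- (1) lower bound on all perfect matchings of `G`
  have hPM_lower : (r : ℝ) ^ n ≤ Real.exp n * (Real.exp (2 * (r : ℝ) ^ 2) * PM.card) := by
    have h1 := factorial_mul_pow_le_permanent hr0 ω
    have h2 := permanent_countMatrix_le ω
    have h3 : ((((Finset.univ : Finset (Equiv.Perm (Fin n))).filter
        fun σ => ∀ i, ∃ k, ω k i = σ i).card : ℕ) : ℝ) ≤ PM.card := by
      have hsub : ((Finset.univ : Finset (Equiv.Perm (Fin n))).filter
          fun σ => ∀ i, ∃ k, ω k i = σ i) ⊆ PM := by
        intro σ hσ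
        rw [hPM, Finset.mem_filter]
        refine ⟨Finset.mem_univ _, fun i => ?_⟩
        rw [hG, Finset.mem_union, mem_padding]
        exact Or.inr ((Finset.mem_filter.mp hσ).2 i)
      exact_mod_cast Finset.card_le_card hsub
    have hagrR := Nat.cast_le (α := ℝ).mpr hagr
    push_cast at hagrR
    have h4 := Real.exp_le_exp.mpr hagrR
    have h5 : (n : ℝ) ^ n ≤ Real.exp n * n.factorial := by
      have := Real.pow_div_factorial_le_exp (x := n) (Nat.cast_nonneg n) n
      rwa [div_le_iff₀ (by positivity)] at this
    have h234 := h2.trans (mul_le_mul h4 h3 (by positivity) (by positivity))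
    have hX : (n.factorial : ℝ) * (r : ℝ) ^ n ≤
        n.factorial * (Real.exp n * (Real.exp (2 * (r : ℝ) ^ 2) * PM.card)) := by
      calc (n.factorial : ℝ) * (r : ℝ) ^ n ≤ _ := h1
        _ ≤ (n : ℝ) ^ n * (Real.exp (2 * (r : ℝ) ^ 2) * PM.card) :=
            mul_le_mul_of_nonneg_left h234 (by positivity)
        _ ≤ (Real.exp n * n.factorial) * (Real.exp (2 * (r : ℝ) ^ 2) * PM.card) := by gcongr
        _ = n.factorial * (Real.exp n * (Real.exp (2 * (r : ℝ) ^ 2) * PM.card)) := by ring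
    exact le_of_mul_le_mul_left hX (by positivity)
  have hPMpos : (0 : ℝ) < PM.card := by
    have hrn : (0 : ℝ) < (r : ℝ) ^ n := by positivity
    by_contra hcon
    push Not at hcon
    have h0 : (PM.card : ℝ) = 0 := le_antisymm hcon (Nat.cast_nonneg _)
    rw [h0, mul_zero, mul_zero] at hPM_lower
    linarith
  -- (2) upper bound on the split-respecting matchings
  rcases RESP.eq_empty_or_nonempty with hR0 | hRne
  · rw [hR0, Finset.card_empty, mul_zero]
    exact Nat.zero_le _
  set Bk : Fin n → Finset (Fin n) := fun j => (Finset.univ : Finset (Fin n)).filter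
    fun x => (x, j) ∈ G ∧ (x ∈ S ↔ j ∈ T) with hBk
  have hblock : ∀ σ ∈ RESP, ∀ j, σ j ∈ Bk j := by
    intro σ hσ j
    obtain ⟨hσG, hσTS⟩ := (Finset.mem_filter.mp hσ).2
    simp only [hBk, Finset.mem_filter, Finset.mem_univ, true_and]
    refine ⟨hσG j, ?_⟩
    rw [← hσTS, Finset.mem_image]
    constructor
    · rintro ⟨j', hj', hj'j⟩
      rwa [← σ.injective hj'j]
    · intro hj
      exact ⟨j, hj, rfl⟩
  have hlogR : Real.log (RESP.card : ℝ) ≤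
      ∑ j, Real.log (((Bk j).card.factorial : ℕ) : ℝ) / ((Bk j).card : ℝ) :=
    log_card_le_sum_log_factorial_div_of_subset RESP hRne Bk hblock
  have hB1 : ∀ j, 1 ≤ (Bk j).card := fun j => by
    obtain ⟨σ, hσ⟩ := hRne
    exact Finset.card_pos.mpr ⟨σ j, hblock σ hσ j⟩
  -- the block degree sum
  set K : ℝ := 19 * (r : ℝ) / 25 with hK
  have hK8 : (8 : ℝ) ≤ K := by rw [hK]; linarith
  have hBsum : (∑ j, ((Bk j).card : ℝ)) ≤ n * K := by
    have e1 : ∀ j, ((Bk j).card : ℝ) ≤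
        d + ((((Finset.univ : Finset (Fin r)).filter
          fun k => (ω k j ∈ S ↔ j ∈ T)).card : ℕ) : ℝ) := by
      intro j
      exact_mod_cast card_block_le ω S₀ hcol S T j
    have e2 := sum_card_filter_iff ω S T hST.symm
    have e3 := hdisc S T hS2 hST.symm
    have e4 : (r : ℝ) * n - 2 * r * S.card + 2 * ((r : ℝ) * ((S.card : ℝ) ^ 2 / n + n / 10)) ≤
        r * n * (5 / 9 + 1 / 5) :=
      split_geometry (by positivity) (by exact_mod_cast hn0) (by exact_mod_cast hS1.le)
        (by exact_mod_cast hS2)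
    have e5 : (d : ℝ) + 1 ≤ r / 400 := by
      have h := Nat.cast_le (α := ℝ).mpr hr
      push_cast at h
      linarith
    calc (∑ j, ((Bk j).card : ℝ))
        ≤ ∑ j : Fin n, ((d : ℝ) + ((((Finset.univ : Finset (Fin r)).filter
            fun k => (ω k j ∈ S ↔ j ∈ T)).card : ℕ) : ℝ)) := Finset.sum_le_sum fun j _ => e1 j
      _ = n * d + ((r : ℝ) * n - 2 * r * S.card +
            2 * ∑ k, ((T.filter fun j => ω k j ∈ S).card : ℝ)) := by
          rw [Finset.sum_add_distrib, e2, Finset.sum_const, Finset.card_univ, Fintype.card_fin,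
            nsmul_eq_mul]
      _ ≤ n * d + ((r : ℝ) * n - 2 * r * S.card +
            2 * ((r : ℝ) * ((S.card : ℝ) ^ 2 / n + n / 10))) := by
          gcongr
      _ ≤ n * d + r * n * (5 / 9 + 1 / 5) := by linarith [e4]
      _ ≤ n * K := by
          rw [hK]
          have hn' : (0 : ℝ) ≤ n := Nat.cast_nonneg n
          have e6 : (n : ℝ) * d ≤ n * (r / 400) := mul_le_mul_of_nonneg_left (by linarith) hn'
          nlinarith [e6, hn']
  have hsumg := sum_log_factorial_div_le hK8 (fun j => (Bk j).card) hB1 hBsum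
  have hnum : Real.log K - 1 + 4 * Real.log K / K + Real.log 2 / 10 ≤ Real.log r - 1 - 2 / 25 :=
    numeric_bound hrR
  -- conclusion, in `ℝ`
  have hfinal : (2 : ℝ) ^ (n / 10) * (RESP.card : ℝ) ≤ (PM.card : ℝ) := by
    have hRpos : (0 : ℝ) < RESP.card := by exact_mod_cast hRne.card_pos
    rw [← Real.log_le_log_iff (by positivity) hPMpos, Real.log_mul (by positivity) hRpos.ne',
      Real.log_pow]
    have hdiv : ((n / 10 : ℕ) : ℝ) ≤ (n : ℝ) / 10 := Nat.cast_div_le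
    have hlogPM : n * Real.log r - n - 2 * (r : ℝ) ^ 2 ≤ Real.log PM.card := by
      have h := Real.log_le_log (by positivity) hPM_lower
      rw [Real.log_pow, Real.log_mul (Real.exp_pos _).ne' (by positivity),
        Real.log_mul (Real.exp_pos _).ne' hPMpos.ne', Real.log_exp, Real.log_exp] at h
      linarith
    have hlog2 : 0 < Real.log 2 := Real.log_pos one_lt_two
    have hnn : (0 : ℝ) ≤ n := Nat.cast_nonneg n
    calc ((n / 10 : ℕ) : ℝ) * Real.log 2 + Real.log (RESP.card : ℝ)
        ≤ (n : ℝ) / 10 * Real.log 2 + n * (Real.log K - 1 + 4 * Real.log K / K) :=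
          add_le_add (mul_le_mul_of_nonneg_right hdiv hlog2.le) (hlogR.trans hsumg)
      _ = n * (Real.log K - 1 + 4 * Real.log K / K + Real.log 2 / 10) := by ring
      _ ≤ n * (Real.log r - 1 - 2 / 25) := by gcongr
      _ = n * Real.log r - n - (2 / 25) * n := by ring
      _ ≤ n * Real.log r - n - 2 * (r : ℝ) ^ 2 := by linarith [hnR]
      _ ≤ Real.log (PM.card : ℝ) := hlogPM
  exact_mod_cast hfinal

/-- **Stub `stub_matchingPadding` (random matching padding makes every sparse host a matching
expander).**  For every `d` there is `n₀` such that for `n ≥ n₀` and every cell set `S₀ ⊆ [n]²`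
with row and column degrees `≤ d` some set `M` of at most `400 (d+1)` permutations makes, in the
host `G = S₀ ∪ ⋃_{π ∈ M} graph π`, the perfect matchings respecting any balanced split `(S, T)`
(`n/3 < |S| = |T| ≤ 2n/3`, `σ(T) = S`) at most a `2^{-⌊n/10⌋}` fraction of all perfect matchings.
Proof: probabilistic method by counting over `r = 400(d+1)`-tuples of permutations
(`exists_good_tuple`: Markov for agreements, exponential Markov with the negatively-correlated
hypergeometric MGF and a union bound over the `4^n` splits), then `main_ineq` (van der Waerden
lower bound, Brégman–Minc upper bound on the two blocks). [folklore] -/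
theorem stub_matchingPadding :
    ∀ (d : ℕ), ∃ n₀ : ℕ, ∀ n ≥ n₀, ∀ (S₀ : Finset (Fin n × Fin n)),
      (∀ i : Fin n, (S₀.filter fun e => e.1 = i).card ≤ d) →
      (∀ j : Fin n, (S₀.filter fun e => e.2 = j).card ≤ d) →
      ∃ M : Finset (Equiv.Perm (Fin n)), M.card ≤ 400 * (d + 1) ∧
        ∀ S T : Finset (Fin n), n < 3 * S.card → 3 * S.card ≤ 2 * n → S.card = T.card →
          2 ^ (n / 10) *
              ((Finset.univ : Finset (Equiv.Perm (Fin n))).filter (fun σ : Equiv.Perm (Fin n) =>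
                (∀ i, (σ i, i) ∈ S₀ ∪ M.biUnion fun π => Finset.univ.image fun i => (π i, i)) ∧
                  T.image ⇑σ = S)).card ≤
            ((Finset.univ : Finset (Equiv.Perm (Fin n))).filter (fun σ : Equiv.Perm (Fin n) =>
                ∀ i, (σ i, i) ∈ S₀ ∪ M.biUnion fun π => Finset.univ.image fun i => (π i, i))).card := by
  intro d
  refine ⟨25 * (400 * (d + 1)) ^ 2 + 2, ?_⟩
  intro n hn S₀ _hrow hcol
  have hn2 : 2 ≤ n := le_trans (Nat.le_add_left 2 _) hn
  obtain ⟨ω, hagr, hdisc⟩ := exists_good_tuple (n := n) (r := 400 * (d + 1)) (by omega) hn2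
  refine ⟨Finset.univ.image ω, Finset.card_image_le.trans (by simp), ?_⟩
  intro S T hS1 hS2 hST
  exact main_ineq le_rfl ω hn hagr hdisc S₀ hcol S T hS1 hS2 hST

end Summit.ValiantsHypothesis.ValiantsHypothesis.Theorems.DivisionGap.PerCofactorDegreeReduction.MatchingPadding
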